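import Mathlib
import HarnessLib
import Summits.HubbardSuperconductivity.HubbardSuperconductivity.Theorems.KLProgrammeKLRegimeSplitTwoLegSizesMSTopProfiles
import Summits.HubbardSuperconductivity.HubbardSuperconductivity.Theorems.KLProgrammeKLRegimeSplitTwoLegSizesMSTubeProfiles
import Summits.HubbardSuperconductivity.HubbardSuperconductivity.Theorems.KLProgrammeKLRegimeSplitTwoLegSizesMSTubeGeometry

/-!
# Route `KLProgramme`, crux K3 — (E3a-MS) supplier chain, TUBE RE-KEY (T5a): the TOP scale `n = n_β + 1` with the one symbol's sizes on the flat tube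
# (k3c3-p1 g4)

Seat hubbard-kl-k3c3-p1 (g4).  At the top scale the (E3a-MS) slot text has no slots and reads ONE increment symbol `S` on the curve of `K` only; the
curve has level zero, so TUBE sizes (`∀ q, |frameLevel μ K q| ≤ dT → …`, any `dT ≥ 0`) suffice:

* `twoLegSizesMSWith_top_of_sizes_osc_tube`, `twoLegSizesMSWith_top_of_frameOK_tube` — `…MSWithPieces` re-keyed (`curveProfile_centred_sizes_osc_on`);
* `twoLegSizesMSTQ_top_of_frameOK_tube` — `…MSQ` re-keyed; **`twoLegSizesMSTQ_top_of_profiles_tube`** — `…MSTopProfiles` re-keyed (fit discharged by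
  `msPieceTop_le`).

Proofs only; nothing about the model.
-/

noncomputable section

namespace Summit.HubbardSuperconductivity.HubbardSuperconductivity.Theorems.KLRegimeSplit

set_option linter.dupNamespace false -- summit = problem name (single-conjunct summit), D-0017

open Real Finset Literature.MathematicalPhysics.QuantumLattice Literature.MathematicalPhysics.QuantumLattice.FermiRG
open Literature.MathematicalPhysics.QuantumLattice.BandSectorCounting
open Summit.HubbardSuperconductivity.HubbardSuperconductivity.Theorems.KLProgrammeLegKernels
open Summit.HubbardSuperconductivity.HubbardSuperconductivity.Theorems.DispersionFlow
open Summit.HubbardSuperconductivity.HubbardSuperconductivity.Theorems.PerturbedFermiCurve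

section MS

variable {L M : ℕ} [NeZero L] [NeZero M] {G : GeoConsts} {Q : EngConsts} {R : RenConsts} {β U μ : ℝ}

/-- **(E3a-MS), parametric, AT THE TOP SCALE, frame-size keyed, oscillation entry, TUBE symbol sizes** — `twoLegSizesMSWith_top_of_sizes_osc` with
the one symbol's sup and sizes assumed only on `{|frameLevel μ K| ≤ dT}` (`0 ≤ dT`; the curve of `K` has level zero). -/
theorem twoLegSizesMSWith_top_of_sizes_osc_tube (hμ : μ ∈ klWindowC) {K : TrigPolyC4v}
    (hc₁ : Continuous (klLocalPart L M β U μ K (nScales β + 1))) (hc₀ : Continuous (klLocalPart L M β U μ K (nScales β)))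
    {S : TrigPolyC4v}
    (hS : ∀ θ, klLocalPart L M β U μ K (nScales β + 1) θ - klLocalPart L M β U μ K (nScales β) θ = S.eval (klFermiPoint μ K θ))
    {A : ℝ} (hA : ∀ p : Momentum, ∀ j ≤ 2, ‖iteratedFDeriv ℝ j (frameShift K) p‖ ≤ A) (hA20 : A ≤ 1 / 20)
    (hd : klCurveD ≤ (bandBounds (show (-4 : ℝ) < -1.1 by norm_num) (show (-1.1 : ℝ) ≤ -0.1 by norm_num)
      (show (-0.1 : ℝ) < 0 by norm_num)).Dtmin - 2 * A)
    (hlo : (-1.1 : ℝ) ≤ μ - A) (hhi : μ + A ≤ -0.1)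
    {A₃ A₄ : ℝ} (hA₃ : ∀ p : Momentum, ‖iteratedFDeriv ℝ 3 (frameShift K) p‖ ≤ A₃)
    (hA₄ : ∀ p : Momentum, ‖iteratedFDeriv ℝ 4 (frameShift K) p‖ ≤ A₄)
    {dT : ℝ} (hdT : 0 ≤ dT) {σ : ℕ → ℝ} (hσnn : ∀ l, 0 ≤ σ l)
    (hσ0 : ∀ q : Momentum, |frameLevel μ K q| ≤ dT → |evalM S q| ≤ σ 0)
    (hσ : ∀ l, 1 ≤ l → l ≤ 4 → ∀ q : Momentum, |frameLevel μ K q| ≤ dT → ‖iteratedFDeriv ℝ l (evalM S) q‖ ≤ σ l)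
    {X : ℝ} (hX : ∀ l ≤ 4, ∀ x : ℝ, ‖iteratedFDeriv ℝ l salmhoferCutoff x‖ ≤ X) (B : ℕ → ℕ → ℝ) :
    TwoLegSizesMSWith L M β U μ K.eval (nScales β + 1) (fun j => extSize X (σ 0) (bellCumOsc σ (msD A₃ A₄) j) j) B := by
  set N := nScales β with hNdef
  have hX0 : 0 ≤ X := cutoffNumeral_nonneg hX
  -- the curve of `K`
  have hcurve := fermiPointLp_sizes_of_sizes hA hA20 hd hlo hhi hA₃ hA₄
  have hC : ContDiff ℝ 4 (fun θ : ℝ => (WithLp.toLp 2 (klFermiPoint μ K θ) : Momentum)) := (hcurve 0).1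
  have hC' : ContDiff ℝ 4 (klFermiPoint μ K) := contDiff_of_contDiff_toLp hC
  have hD : ∀ i, 1 ≤ i → i ≤ 4 → ∀ θ,
      ‖iteratedDeriv i (fun θ : ℝ => (WithLp.toLp 2 (klFermiPoint μ K θ) : Momentum)) θ‖ ≤ msD A₃ A₄ i := by
    intro i hi1 hi4 θ
    obtain ⟨-, d1, d2, d3, d4⟩ := hcurve θ
    rw [← norm_iteratedFDeriv_eq_norm_iteratedDeriv]
    interval_cases i
    · exact d1
    · exact d2
    · exact d3
    · exact d4
  have hDnn : ∀ i, 0 ≤ msD A₃ A₄ i := by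
    intro i
    rcases i with _ | _ | _ | _ | _ | i
    · simp [msD]
    · exact (norm_nonneg _).trans (hD 1 le_rfl (by norm_num) 0)
    · exact (norm_nonneg _).trans (hD 2 (by norm_num) (by norm_num) 0)
    · exact (norm_nonneg _).trans (hD 3 (by norm_num) (by norm_num) 0)
    · exact (norm_nonneg _).trans (hD 4 (by norm_num) (by norm_num) 0)
    · simp [msD]
  -- the curve of `K` lies in the tube (level zero)
  have hT : ∀ θ : ℝ, |frameLevel μ K (WithLp.toLp 2 (klFermiPoint μ K θ))| ≤ dT := fun θ => by
    rw [frameLevel_klFermiPoint (bandBounds (show (-4 : ℝ) < -1.1 by norm_num) (show (-1.1 : ℝ) ≤ -0.1 by norm_num)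
      (show (-0.1 : ℝ) < 0 by norm_num)) hA hlo hhi θ, abs_zero]
    exact hdT
  -- the piece
  have hδ : (fun θ => klLocalPart L M β U μ K (N + 1) θ - klLocalPart L M β U μ K N θ) = curveProfile μ S K := by
    funext θ; rw [hS θ]; rfl
  have hP : klTwoLegPieceFn L M β U μ K.eval (N + 1) = klFrameExtFn μ (curveProfile μ S K) := by
    rw [klTwoLegPieceFn_eval_succ β U μ K N hc₁ hc₀, hδ]
  -- the (trivial) split
  set p : ℕ → ℝ → ℝ := fun m => if m = N + 1 then curveProfile μ S K else fun _ => 0 with hpdef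
  have hpN : p (N + 1) = curveProfile μ S K := by simp [hpdef]
  have hpm : ∀ m, m ≠ N + 1 → p m = fun _ => 0 := fun m hm => by simp [hpdef, hm]
  have hempty : Ioc (N + 1) (nScales β) = ∅ := Finset.Ioc_eq_empty_of_le (by omega)
  have hW := twoLegSizesMSWith_of_profile_split hμ hP p ?_ ?_ ?_ ?_ ?_ hX
    (fun m j => if m = N + 1 then bellCumOsc σ (msD A₃ A₄) j else 0) ?_
  · refine hW.mono ?_ ?_
    · intro j _
      rw [if_pos rfl, hpN]
      refine extSize_mono hX0 (abs_klAngularMean_le' fun θ => ?_) le_rfl j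
      rw [curveProfile_apply]; exact hσ0 _ (hT θ)
    · intro m hm
      rw [hempty] at hm
      exact absurd hm (Finset.notMem_empty m)
  · intro θ; rw [hempty, Finset.sum_empty, hpN, add_zero]
  · intro m
    by_cases hm : m = N + 1
    · subst hm; rw [hpN]; exact contDiff_curveProfile μ S K hC'
    · rw [hpm m hm]; exact contDiff_const
  · intro m θ
    by_cases hm : m = N + 1
    · subst hm; simp only [hpN, curveProfile, klFermiPoint_periodic μ _ θ]
    · simp only [hpm m hm]
  · intro m θ
    by_cases hm : m = N + 1
    · subst hm; simp only [hpN, curveProfile, klFermiPoint_neg, TrigPolyC4v.eval_reflect]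
    · simp only [hpm m hm]
  · intro m θ
    by_cases hm : m = N + 1
    · subst hm; simp only [hpN, curveProfile, klFermiPoint_pi_div_two_sub, TrigPolyC4v.eval_swap]
    · simp only [hpm m hm]
  · intro m j hj i hi t
    by_cases hm : m = N + 1
    · subst hm
      rw [hpN, if_pos rfl]
      exact curveProfile_centred_sizes_osc_on μ S K hC hσnn hDnn (fun θ => hσ0 _ (hT θ)) (fun l hl1 hl4 θ => hσ l hl1 hl4 _ (hT θ)) hD hj hi t
    · rw [hpm m hm, if_neg hm, klAngularMean_zero]
      simp


/-- **(E3a-MS), parametric, AT THE TOP SCALE IN THE KL REGIME** (`FrameOK`-keyed, thresholds `klCurveC3 R`, `klCurveU0 R`) — binders of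
`twoLegSizesMST_top_of_frameOK` minus the fit; conclusion the slot text at the computed base size `msPieceTop` (slot family arbitrary; at the top
the full-frame budgets `topA3/topA4` are the right scale, so nothing is graded here; oscillation entry). -/
theorem twoLegSizesMSWith_top_of_frameOK_tube (hR : ∀ j, 0 ≤ R.Gfr j) {c : ℝ} (hc : 0 < c) (hcle : c ≤ klCurveC3 R)
    (hU : 0 < U) (hUle : U ≤ klCurveU0 R) (hβmin : klBetaMin ≤ β) (hβc : β ≤ Real.exp (c / U ^ 2)) (hμ : μ ∈ klWindowC)
    {K : TrigPolyC4v} (hK : FrameOK R U (nScales β) μ K)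
    (hc₁ : Continuous (klLocalPart L M β U μ K (nScales β + 1))) (hc₀ : Continuous (klLocalPart L M β U μ K (nScales β)))
    {S : TrigPolyC4v}
    (hS : ∀ θ, klLocalPart L M β U μ K (nScales β + 1) θ - klLocalPart L M β U μ K (nScales β) θ = S.eval (klFermiPoint μ K θ))
    {dT : ℝ} (hdT : 0 ≤ dT) {σ : ℕ → ℝ} (hσnn : ∀ l, 0 ≤ σ l)
    (hσ0 : ∀ q : Momentum, |frameLevel μ K q| ≤ dT → |evalM S q| ≤ σ 0)
    (hσ : ∀ l, 1 ≤ l → l ≤ 4 → ∀ q : Momentum, |frameLevel μ K q| ≤ dT → ‖iteratedFDeriv ℝ l (evalM S) q‖ ≤ σ l)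
    {X : ℝ} (hX : ∀ l ≤ 4, ∀ x : ℝ, ‖iteratedFDeriv ℝ l salmhoferCutoff x‖ ≤ X) (B : ℕ → ℕ → ℝ) :
    TwoLegSizesMSWith L M β U μ K.eval (nScales β + 1) (msPieceTop X σ R U (nScales β)) B := by
  obtain ⟨hAf, hA20, -, hhalf, ⟨hlo, hhi⟩, hA3f, hA4f⟩ := frame_sizes_of_frameOK_explicit hR hc hcle hU hUle hβmin hβc hμ hK
  exact twoLegSizesMSWith_top_of_sizes_osc_tube hμ hc₁ hc₀ hS hAf hA20 hhalf hlo hhi hA3f hA4f hdT hσnn hσ0 hσ hX B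


/-- **(E3a-MS-TQ) AT THE TOP SCALE, `FrameOK`-keyed, TUBE symbol sizes** — `twoLegSizesMSTQ_top_of_frameOK` re-keyed. -/
theorem twoLegSizesMSTQ_top_of_frameOK_tube (hR : ∀ j, 0 ≤ R.Gfr j) {c : ℝ} (hc : 0 < c) (hcle : c ≤ klCurveC3 R)
    (hU : 0 < U) (hUle : U ≤ klCurveU0 R) (hβmin : klBetaMin ≤ β) (hβc : β ≤ Real.exp (c / U ^ 2)) (hμ : μ ∈ klWindowC)
    {K : TrigPolyC4v} (hK : FrameOK R U (nScales β) μ K)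
    (hc₁ : Continuous (klLocalPart L M β U μ K (nScales β + 1))) (hc₀ : Continuous (klLocalPart L M β U μ K (nScales β)))
    {S : TrigPolyC4v}
    (hS : ∀ θ, klLocalPart L M β U μ K (nScales β + 1) θ - klLocalPart L M β U μ K (nScales β) θ = S.eval (klFermiPoint μ K θ))
    {dT : ℝ} (hdT : 0 ≤ dT) {σ : ℕ → ℝ} (hσnn : ∀ l, 0 ≤ σ l)
    (hσ0 : ∀ q : Momentum, |frameLevel μ K q| ≤ dT → |evalM S q| ≤ σ 0)
    (hσ : ∀ l, 1 ≤ l → l ≤ 4 → ∀ q : Momentum, |frameLevel μ K q| ≤ dT → ‖iteratedFDeriv ℝ l (evalM S) q‖ ≤ σ l)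
    {X : ℝ} (hX : ∀ l ≤ 4, ∀ x : ℝ, ‖iteratedFDeriv ℝ l salmhoferCutoff x‖ ≤ X)
    (hfit : ∀ j ≤ 4, msPieceTop X σ R U (nScales β) j ≤ twoLegBar G Q U j (nScales β + 1)) :
    TwoLegSizesMSTQ L M G Q R β U μ K (nScales β + 1) :=
  (twoLegSizesMSWith_top_of_frameOK_tube hR hc hcle hU hUle hβmin hβc hμ hK hc₁ hc₀ hS hdT hσnn hσ0 hσ hX
    (fun m j => msBarQ G Q U (nScales β + 1) * (R.Gfr j * uPow j U * (4 : ℝ) ^ (((j : ℤ) - 2) * m)))).toMSTQ hfit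
    (fun _ _ _ _ => le_rfl)

/-- **(E3a-MS-TQ) AT THE TOP SCALE FROM THE ENGINE PROFILE, TUBE symbol sizes** — `twoLegSizesMSTQ_top_of_profiles` re-keyed. -/
theorem twoLegSizesMSTQ_top_of_profiles_tube (hR : ∀ j, 0 ≤ R.Gfr j) {c : ℝ} (hc : 0 < c) (hcle : c ≤ klCurveC3 R)
    (hU : 0 < U) (hUle : U ≤ klCurveU0 R) (hU1 : U ≤ 1) (hβmin : klBetaMin ≤ β) (hβc : β ≤ Real.exp (c / U ^ 2)) (hμ : μ ∈ klWindowC)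
    {K : TrigPolyC4v} (hK : FrameOK R U (nScales β) μ K)
    (hc₁ : Continuous (klLocalPart L M β U μ K (nScales β + 1))) (hc₀ : Continuous (klLocalPart L M β U μ K (nScales β)))
    {S : TrigPolyC4v}
    (hS : ∀ θ, klLocalPart L M β U μ K (nScales β + 1) θ - klLocalPart L M β U μ K (nScales β) θ = S.eval (klFermiPoint μ K θ))
    {dT : ℝ} (hdT : 0 ≤ dT) {σ : ℕ → ℝ} (hσnn : ∀ l, 0 ≤ σ l)
    (hσ0 : ∀ q : Momentum, |frameLevel μ K q| ≤ dT → |evalM S q| ≤ σ 0)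
    (hσ : ∀ l, 1 ≤ l → l ≤ 4 → ∀ q : Momentum, |frameLevel μ K q| ≤ dT → ‖iteratedFDeriv ℝ l (evalM S) q‖ ≤ σ l)
    {X : ℝ} (hX : ∀ l ≤ 4, ∀ x : ℝ, ‖iteratedFDeriv ℝ l salmhoferCutoff x‖ ≤ X)
    (hS' : ∀ j, 0 ≤ Q.S' j) {mu : ℕ → ℝ} (hmu : ∀ i, 0 ≤ mu i)
    (hs0 : σ 0 ≤ 16 * mu 0 * U ^ 2 / ((4 : ℝ) ^ (nScales β + 1)) ^ 2) (hs1 : σ 1 ≤ 4 * mu 1 * U ^ 2 / (4 : ℝ) ^ (nScales β + 1))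
    (hs2 : σ 2 ≤ mu 2 * U ^ 2) (hs3 : σ 3 ≤ mu 3 * U ^ 2 * (4 : ℝ) ^ (nScales β + 1) / 4)
    (hs4 : σ 4 ≤ mu 4 * U ^ 2 * ((4 : ℝ) ^ (nScales β + 1)) ^ 2 / 16)
    {lam3 lam4 : ℝ} (hlam3 : 0 ≤ lam3) (hlam4 : 0 ≤ lam4)
    (hfit0 : ∀ j ≤ 4, msReqBase0 X mu j ≤ G.S j / 2) (hfit1 : ∀ j ≤ 4, U * msReqBase1 X mu R lam3 lam4 j ≤ G.S j / 2) :
    TwoLegSizesMSTQ L M G Q R β U μ K (nScales β + 1) :=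
  twoLegSizesMSTQ_top_of_frameOK_tube hR hc hcle hU hUle hβmin hβc hμ hK hc₁ hc₀ hS hdT hσnn hσ0 hσ hX
    (msPieceTop_le hR hU hU1 (le_trans (norm_nonneg _) (hX 0 (by norm_num) 0)) hlam3 hlam4 hS' hmu hσnn hs0 hs1 hs2 hs3 hs4
      hfit0 hfit1)

end MS

end Summit.HubbardSuperconductivity.HubbardSuperconductivity.Theorems.KLRegimeSplit

end
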